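import Mathlib
import Literature.Probability.Process.PointStationaryLaw
import Literature.MathematicalPhysics.StatisticalMechanics.RootEnergy
import Summits.AtomisticToContinuum.Crystallization.Theorems.MinimisingLawsCohesive.Negative.OnePointMixtures
import Summits.AtomisticToContinuum.Crystallization.Theorems.MinimiserShells.Negative.Rootedness

/-!
# Stub `stub_pureExhaustion` of line `purity_stacking` — crux
# `IsometryAtoms.MinimisingLawsCohesive` (stmt-AtomisticToContinuum-15777), Aux file 1:
# rooted isometry classes and almost-invariant conditioning

Toolkit for the exhaustion of a minimising point-stationary hard-core law by its charged rooted
isometry classes.  The *rooted isometry class* of a point set `Y ⊂ ℝ³` is the event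
`Cls Y := {count|A(Y − q) : A a linear isometry, q ∈ Y}` (written out as a set-builder term
everywhere, exactly as in the route items of `Theses.IsometryAtoms`).

* §1 class algebra (`count|S` determines `S`: evaluate at singletons): a rooted isometric copy
  of a rooted isometric copy is a rooted isometric copy (`image_image_sub`); classes are
  invariant under rooted isometric copies (`cls_image_eq`), hence EQUAL OR DISJOINT
  (`cls_eq_of_mem_of_mem`); re-rooting a member of a class at one of its points stays in the
  class (`map_sub_mem_cls`); a class containing (or charged by a law a.s. carried by)
  `δ`-hard-core configurations is the class of a `δ`-separated set
  (`separated_of_isRootedHardCore`, `separated_of_measure_ne_zero`).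
* §2 measurability of the class of a separated set from measurability of its `q`-slices
  (`measurableSet_cls`).
* §3 conditioning on an ALMOST-invariant event:
  `pureExhaustion_isPointStationaryLaw_restrict_of_ae` (anchor, registered on the crux item) and
  `integral_rootEnergy_cond_le_of_ae` — the a.e. versions of
  `Rootedness.isPointStationaryLaw_restrict` / `Rootedness.meanRootEnergy_cond_le_of_minimising`
  (invariance `θ_y μ ∈ A ↔ μ ∈ A` only for `P`-a.e. `μ` and `μ`-a.e. `y`, which is what a union
  of rooted isometry classes satisfies: re-rooting at a NON-point leaves the class).

All `[folklore]`.
-/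

noncomputable section

open MeasureTheory Set Filter
open scoped ENNReal

namespace Summit.AtomisticToContinuum.Crystallization.Theorems.IsometryAtomsMinimisingLawsCohesive

namespace PureExhaustion

open Literature.Probability.Process
open Literature.MathematicalPhysics.StatisticalMechanics
open Summit.AtomisticToContinuum.Crystallization.Theorems.ChargedEnergyGapNegative (eStar)
open Summit.AtomisticToContinuum.Crystallization.Theorems.PricedLinkCensusLocalToGlobalPhaseGap
  (eStar_le_neg)
open Summit.AtomisticToContinuum.Crystallization.Theorems.MinimiserShells.Negative.Rootedness
  (countable_of_separated)

/-! ## §1 Class algebra -/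

/-- A rooted isometric copy of a rooted isometric copy is a rooted isometric copy:
`B((A(Y − q)) − A(p − q)) = (B ∘ A)(Y − p)`. [folklore] -/
theorem image_image_sub (A B : EuclideanSpace ℝ (Fin 3) →ₗᵢ[ℝ] EuclideanSpace ℝ (Fin 3))
    (q p : EuclideanSpace ℝ (Fin 3)) (Y : Set (EuclideanSpace ℝ (Fin 3))) :
    (fun s => B (s - A (p - q))) '' ((fun s => A (s - q)) '' Y) =
      (fun s => (B.comp A) (s - p)) '' Y := by
  rw [Set.image_image]
  refine Set.image_congr fun s _ => ?_
  rw [LinearIsometry.coe_comp, Function.comp_apply, ← map_sub, sub_sub_sub_cancel_right]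

/-- Re-rooting a rooted isometric copy at one of its points: `A(Y − q) − A(p − q) = A(Y − p)`.
[folklore] -/
theorem image_sub_image_sub (A : EuclideanSpace ℝ (Fin 3) →ₗᵢ[ℝ] EuclideanSpace ℝ (Fin 3))
    (q p : EuclideanSpace ℝ (Fin 3)) (Y : Set (EuclideanSpace ℝ (Fin 3))) :
    (fun s => s - A (p - q)) '' ((fun s => A (s - q)) '' Y) = (fun s => A (s - p)) '' Y := by
  rw [Set.image_image]
  refine Set.image_congr fun s _ => ?_
  rw [← map_sub, sub_sub_sub_cancel_right]

/-- One inclusion of the invariance of classes under rooted isometric copies: a rooted isometric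
copy of `A(Y − q)` rooted at one of its points is a rooted isometric copy of `Y`. [folklore] -/
theorem mem_cls_of_eq_image_image {Y : Set (EuclideanSpace ℝ (Fin 3))}
    (A B : EuclideanSpace ℝ (Fin 3) →ₗᵢ[ℝ] EuclideanSpace ℝ (Fin 3)) (q : EuclideanSpace ℝ (Fin 3))
    {p' : EuclideanSpace ℝ (Fin 3)} (hp' : p' ∈ (fun s => A (s - q)) '' Y) :
    (Measure.count : Measure (EuclideanSpace ℝ (Fin 3))).restrict
        ((fun s => B (s - p')) '' ((fun s => A (s - q)) '' Y)) ∈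
      {ν : Measure (EuclideanSpace ℝ (Fin 3)) |
        ∃ A : EuclideanSpace ℝ (Fin 3) →ₗᵢ[ℝ] EuclideanSpace ℝ (Fin 3), ∃ q ∈ Y,
          ν = (Measure.count : Measure (EuclideanSpace ℝ (Fin 3))).restrict
            ((fun s => A (s - q)) '' Y)} := by
  obtain ⟨p, hp, rfl⟩ := hp'
  exact ⟨B.comp A, p, hp, by rw [image_image_sub]⟩

/-- **Classes are invariant under rooted isometric copies**: `Cls (A(Y − q)) = Cls Y`
(linear isometries of `ℝ³` are invertible). [folklore] -/
theorem cls_image_eq {Y : Set (EuclideanSpace ℝ (Fin 3))}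
    (A : EuclideanSpace ℝ (Fin 3) →ₗᵢ[ℝ] EuclideanSpace ℝ (Fin 3)) (q : EuclideanSpace ℝ (Fin 3)) :
    {ν : Measure (EuclideanSpace ℝ (Fin 3)) |
        ∃ B : EuclideanSpace ℝ (Fin 3) →ₗᵢ[ℝ] EuclideanSpace ℝ (Fin 3),
          ∃ p ∈ (fun s => A (s - q)) '' Y,
            ν = (Measure.count : Measure (EuclideanSpace ℝ (Fin 3))).restrict
              ((fun s => B (s - p)) '' ((fun s => A (s - q)) '' Y))} =
      {ν : Measure (EuclideanSpace ℝ (Fin 3)) |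
        ∃ A : EuclideanSpace ℝ (Fin 3) →ₗᵢ[ℝ] EuclideanSpace ℝ (Fin 3), ∃ q ∈ Y,
          ν = (Measure.count : Measure (EuclideanSpace ℝ (Fin 3))).restrict
            ((fun s => A (s - q)) '' Y)} := by
  ext ν
  simp only [Set.mem_setOf_eq]
  constructor
  · rintro ⟨B, p', hp', rfl⟩
    exact mem_cls_of_eq_image_image A B q hp'
  · rintro ⟨B, p, hp, rfl⟩
    -- invert `A`
    set Ae : EuclideanSpace ℝ (Fin 3) ≃ₗᵢ[ℝ] EuclideanSpace ℝ (Fin 3) :=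
      A.toLinearIsometryEquiv rfl with hAe
    refine ⟨B.comp Ae.symm.toLinearIsometry, A (p - q), ⟨p, hp, rfl⟩, ?_⟩
    rw [image_image_sub]
    congr 1
    refine Set.image_congr fun s _ => ?_
    simp only [LinearIsometry.coe_comp, Function.comp_apply,
      LinearIsometryEquiv.coe_toLinearIsometry]
    rw [show A (s - p) = Ae (s - p) from by rw [hAe, LinearIsometry.coe_toLinearIsometryEquiv],
      LinearIsometryEquiv.symm_apply_apply]

/-- **Rooted isometry classes are equal or disjoint**: two classes with a common member coincide
(a counting measure determines its carrier — evaluate at singletons — and `cls_image_eq`).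
[folklore] -/
theorem cls_eq_of_mem_of_mem {Y Y' : Set (EuclideanSpace ℝ (Fin 3))}
    {ν : Measure (EuclideanSpace ℝ (Fin 3))}
    (hν : ν ∈ {ν : Measure (EuclideanSpace ℝ (Fin 3)) |
        ∃ A : EuclideanSpace ℝ (Fin 3) →ₗᵢ[ℝ] EuclideanSpace ℝ (Fin 3), ∃ q ∈ Y,
          ν = (Measure.count : Measure (EuclideanSpace ℝ (Fin 3))).restrict
            ((fun s => A (s - q)) '' Y)})
    (hν' : ν ∈ {ν : Measure (EuclideanSpace ℝ (Fin 3)) |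
        ∃ A : EuclideanSpace ℝ (Fin 3) →ₗᵢ[ℝ] EuclideanSpace ℝ (Fin 3), ∃ q ∈ Y',
          ν = (Measure.count : Measure (EuclideanSpace ℝ (Fin 3))).restrict
            ((fun s => A (s - q)) '' Y')}) :
    {ν : Measure (EuclideanSpace ℝ (Fin 3)) |
        ∃ A : EuclideanSpace ℝ (Fin 3) →ₗᵢ[ℝ] EuclideanSpace ℝ (Fin 3), ∃ q ∈ Y,
          ν = (Measure.count : Measure (EuclideanSpace ℝ (Fin 3))).restrict
            ((fun s => A (s - q)) '' Y)} =
      {ν : Measure (EuclideanSpace ℝ (Fin 3)) |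
        ∃ A : EuclideanSpace ℝ (Fin 3) →ₗᵢ[ℝ] EuclideanSpace ℝ (Fin 3), ∃ q ∈ Y',
          ν = (Measure.count : Measure (EuclideanSpace ℝ (Fin 3))).restrict
            ((fun s => A (s - q)) '' Y')} := by
  obtain ⟨A, q, -, rfl⟩ := hν
  obtain ⟨A', q', -, h⟩ := hν'
  -- a counting measure determines its carrier (evaluate at singletons)
  have hS : (fun s => A (s - q)) '' Y = (fun s => A' (s - q')) '' Y' := Set.ext fun y => by
    rw [← count_restrict_singleton_ne_zero_iff _ y, ← count_restrict_singleton_ne_zero_iff _ y, h]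
  have h1 := cls_image_eq A q (Y := Y)
  rw [hS] at h1
  exact h1.symm.trans (cls_image_eq A' q')

/-- **Re-rooting inside a class**: re-rooting a member of the class of `Y` at one of its points
gives a member of the class of `Y`. [folklore] -/
theorem map_sub_mem_cls {Y : Set (EuclideanSpace ℝ (Fin 3))}
    {ν : Measure (EuclideanSpace ℝ (Fin 3))}
    (hν : ν ∈ {ν : Measure (EuclideanSpace ℝ (Fin 3)) |
        ∃ A : EuclideanSpace ℝ (Fin 3) →ₗᵢ[ℝ] EuclideanSpace ℝ (Fin 3), ∃ q ∈ Y,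
          ν = (Measure.count : Measure (EuclideanSpace ℝ (Fin 3))).restrict
            ((fun s => A (s - q)) '' Y)})
    {y : EuclideanSpace ℝ (Fin 3)} (hy : ν {y} ≠ 0) :
    Measure.map (fun z => z - y) ν ∈ {ν : Measure (EuclideanSpace ℝ (Fin 3)) |
        ∃ A : EuclideanSpace ℝ (Fin 3) →ₗᵢ[ℝ] EuclideanSpace ℝ (Fin 3), ∃ q ∈ Y,
          ν = (Measure.count : Measure (EuclideanSpace ℝ (Fin 3))).restrict
            ((fun s => A (s - q)) '' Y)} := by
  obtain ⟨A, q, hq, rfl⟩ := hν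
  have hyS := (count_restrict_singleton_ne_zero_iff _ y).1 hy
  obtain ⟨p, hp, rfl⟩ := hyS
  refine ⟨A, p, hp, ?_⟩
  rw [map_sub_count_restrict, image_sub_image_sub]

/-- A class containing a rooted `δ`-hard-core configuration is the class of a `δ`-separated set.
[folklore] -/
theorem separated_of_isRootedHardCore {δ : ℝ} {Y : Set (EuclideanSpace ℝ (Fin 3))}
    {A : EuclideanSpace ℝ (Fin 3) →ₗᵢ[ℝ] EuclideanSpace ℝ (Fin 3)} {q : EuclideanSpace ℝ (Fin 3)}
    (h : IsRootedHardCore δ ((Measure.count : Measure (EuclideanSpace ℝ (Fin 3))).restrict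
      ((fun s => A (s - q)) '' Y))) :
    ∀ x ∈ Y, ∀ y ∈ Y, x ≠ y → δ ≤ dist x y := by
  obtain ⟨S, -, hsep, hS⟩ := h
  have hYS : (fun s => A (s - q)) '' Y = S := Set.ext fun y => by
    rw [← count_restrict_singleton_ne_zero_iff _ y, ← count_restrict_singleton_ne_zero_iff _ y, hS]
  intro x hx y hy hxy
  have h := hsep (A (x - q)) (hYS ▸ ⟨x, hx, rfl⟩) (A (y - q)) (hYS ▸ ⟨y, hy, rfl⟩) fun hA =>
    hxy (sub_left_injective (A.injective hA))
  rwa [LinearIsometry.dist_map, dist_sub_right] at h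

/-- A class charged by a measure under which almost every configuration is `δ`-hard-core contains
a `δ`-hard-core configuration, hence is the class of a `δ`-separated set. [folklore] -/
theorem separated_of_measure_ne_zero {δ : ℝ} {Y : Set (EuclideanSpace ℝ (Fin 3))}
    {P : Measure (Measure (EuclideanSpace ℝ (Fin 3)))} (hcore : ∀ᵐ μ ∂P, IsRootedHardCore δ μ)
    (hpos : P {ν : Measure (EuclideanSpace ℝ (Fin 3)) |
        ∃ A : EuclideanSpace ℝ (Fin 3) →ₗᵢ[ℝ] EuclideanSpace ℝ (Fin 3), ∃ q ∈ Y,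
          ν = (Measure.count : Measure (EuclideanSpace ℝ (Fin 3))).restrict
            ((fun s => A (s - q)) '' Y)} ≠ 0) :
    ∀ x ∈ Y, ∀ y ∈ Y, x ≠ y → δ ≤ dist x y := by
  by_contra hnot
  apply hpos
  refine measure_mono_null ?_ (ae_iff.1 hcore)
  rintro ν ⟨A, q, -, rfl⟩ hcoreν
  exact hnot (separated_of_isRootedHardCore hcoreν)

/-! ## §2 Measurability of classes of separated sets -/

/-- The class of a `δ`-separated set (`δ > 0`) is measurable once its `q`-slices
`{count|A(Y − q) : A}` are: `Y` is countable. [folklore] -/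
theorem measurableSet_cls
    (hMC : ∀ δ : ℝ, 0 < δ → ∀ Y : Set (EuclideanSpace ℝ (Fin 3)),
      (∀ x ∈ Y, ∀ y ∈ Y, x ≠ y → δ ≤ dist x y) → ∀ q : EuclideanSpace ℝ (Fin 3),
      MeasurableSet {μ : Measure (EuclideanSpace ℝ (Fin 3)) |
        ∃ A : EuclideanSpace ℝ (Fin 3) →ₗᵢ[ℝ] EuclideanSpace ℝ (Fin 3),
          μ = (Measure.count : Measure (EuclideanSpace ℝ (Fin 3))).restrict
            ((fun s => A (s - q)) '' Y)})
    {δ : ℝ} (hδ : 0 < δ) {Y : Set (EuclideanSpace ℝ (Fin 3))}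
    (hsep : ∀ x ∈ Y, ∀ y ∈ Y, x ≠ y → δ ≤ dist x y) :
    MeasurableSet {ν : Measure (EuclideanSpace ℝ (Fin 3)) |
        ∃ A : EuclideanSpace ℝ (Fin 3) →ₗᵢ[ℝ] EuclideanSpace ℝ (Fin 3), ∃ q ∈ Y,
          ν = (Measure.count : Measure (EuclideanSpace ℝ (Fin 3))).restrict
            ((fun s => A (s - q)) '' Y)} := by
  have hrepr : {ν : Measure (EuclideanSpace ℝ (Fin 3)) |
        ∃ A : EuclideanSpace ℝ (Fin 3) →ₗᵢ[ℝ] EuclideanSpace ℝ (Fin 3), ∃ q ∈ Y,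
          ν = (Measure.count : Measure (EuclideanSpace ℝ (Fin 3))).restrict
            ((fun s => A (s - q)) '' Y)} =
      ⋃ q ∈ Y, {μ : Measure (EuclideanSpace ℝ (Fin 3)) |
        ∃ A : EuclideanSpace ℝ (Fin 3) →ₗᵢ[ℝ] EuclideanSpace ℝ (Fin 3),
          μ = (Measure.count : Measure (EuclideanSpace ℝ (Fin 3))).restrict
            ((fun s => A (s - q)) '' Y)} := by
    ext ν
    simp only [Set.mem_setOf_eq, Set.mem_iUnion, exists_prop]
    constructor
    · rintro ⟨A, q, hq, h⟩
      exact ⟨q, hq, A, h⟩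
    · rintro ⟨q, hq, A, h⟩
      exact ⟨A, q, hq, h⟩
  rw [hrepr]
  exact MeasurableSet.biUnion (countable_of_separated hδ hsep) fun q _ => hMC δ hδ Y hsep q

/-! ## §3 Conditioning on an almost-invariant event -/

/-- **Conditioning on an almost re-rooting-invariant event preserves point-stationarity**: if
`θ_y μ ∈ A ↔ μ ∈ A` for `P`-a.e. `μ` and `μ`-a.e. `y`, then `P|A` is point-stationary (the Mecke
identity for `1_A(μ) g(μ, y)`; a.e. version of `Rootedness.isPointStationaryLaw_restrict`).
Anchor theorem of this file (registered on the crux item). [folklore] -/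
theorem pureExhaustion_isPointStationaryLaw_restrict_of_ae : ∀ P : MeasureTheory.Measure (MeasureTheory.Measure (EuclideanSpace ℝ (Fin 3))), Literature.Probability.Process.IsPointStationaryLaw P → ∀ A : Set (MeasureTheory.Measure (EuclideanSpace ℝ (Fin 3))), MeasurableSet A → (∀ᵐ μ ∂P, ∀ᵐ y ∂μ, (MeasureTheory.Measure.map (fun z => z - y) μ ∈ A ↔ μ ∈ A)) → Literature.Probability.Process.IsPointStationaryLaw (P.restrict A) := by
  intro P hP A hA hinv
  classical
  intro g hg
  set c : Measure (EuclideanSpace ℝ (Fin 3)) → ℝ≥0∞ := A.indicator fun _ => 1 with hc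
  have hcm : Measurable c := measurable_const.indicator hA
  have hc_top : ∀ μ, c μ ≠ ⊤ := fun μ => by
    by_cases hμ : μ ∈ A
    · rw [hc, Set.indicator_of_mem hμ]; exact ENNReal.one_ne_top
    · rw [hc, Set.indicator_of_notMem hμ]; exact ENNReal.zero_ne_top
  have hc_map : ∀ᵐ μ ∂P, ∀ᵐ y ∂μ, c (Measure.map (fun z => z - y) μ) = c μ := by
    filter_upwards [hinv] with μ hμ
    filter_upwards [hμ] with y hy
    by_cases hμA : μ ∈ A
    · rw [hc, Set.indicator_of_mem hμA, Set.indicator_of_mem (hy.2 hμA)]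
    · rw [hc, Set.indicator_of_notMem hμA, Set.indicator_of_notMem fun h => hμA (hy.1 h)]
  have pull : ∀ F : Measure (EuclideanSpace ℝ (Fin 3)) → ℝ≥0∞,
      ∫⁻ μ in A, F μ ∂P = ∫⁻ μ, c μ * F μ ∂P := by
    intro F
    rw [← lintegral_indicator hA]
    refine lintegral_congr fun μ => ?_
    by_cases hμ : μ ∈ A
    · rw [Set.indicator_of_mem hμ, hc, Set.indicator_of_mem hμ, one_mul]
    · rw [Set.indicator_of_notMem hμ, hc, Set.indicator_of_notMem hμ, zero_mul]
  have hg' : Measurable (Function.uncurry fun μ y => c μ * g μ y) :=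
    (hcm.comp measurable_fst).mul hg
  rw [pull, pull]
  calc ∫⁻ μ, c μ * ∫⁻ y, g μ y ∂μ ∂P = ∫⁻ μ, ∫⁻ y, c μ * g μ y ∂μ ∂P := by
        refine lintegral_congr fun μ => ?_
        rw [lintegral_const_mul' _ _ (hc_top μ)]
    _ = ∫⁻ μ, ∫⁻ y, c (Measure.map (fun z => z - y) μ) *
          g (Measure.map (fun z => z - y) μ) (-y) ∂μ ∂P := hP _ hg'
    _ = ∫⁻ μ, c μ * ∫⁻ y, g (Measure.map (fun z => z - y) μ) (-y) ∂μ ∂P := by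
        refine lintegral_congr_ae ?_
        filter_upwards [hc_map] with μ hμ
        rw [← lintegral_const_mul' _ _ (hc_top μ)]
        refine lintegral_congr_ae ?_
        filter_upwards [hμ] with y hy
        rw [hy]

/-- The complement of an almost re-rooting-invariant event is almost re-rooting-invariant.
[folklore] -/
theorem ae_invariant_compl {P : Measure (Measure (EuclideanSpace ℝ (Fin 3)))}
    {A : Set (Measure (EuclideanSpace ℝ (Fin 3)))}
    (hinv : ∀ᵐ μ ∂P, ∀ᵐ y ∂μ, (Measure.map (fun z => z - y) μ ∈ A ↔ μ ∈ A)) :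
    ∀ᵐ μ ∂P, ∀ᵐ y ∂μ, (Measure.map (fun z => z - y) μ ∈ Aᶜ ↔ μ ∈ Aᶜ) :=
  hinv.mono fun _ hμ => hμ.mono fun _ hy => not_congr hy

/-- The conditioned law `P(A)⁻¹ • P|A` of a probability law on an event of positive probability is
a probability law. [folklore] -/
theorem isProbabilityMeasure_cond {P : Measure (Measure (EuclideanSpace ℝ (Fin 3)))}
    [IsProbabilityMeasure P] {A : Set (Measure (EuclideanSpace ℝ (Fin 3)))} (hpA : P A ≠ 0) :
    IsProbabilityMeasure ((P A)⁻¹ • P.restrict A) :=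
  ⟨by rw [Measure.smul_apply, Measure.restrict_apply MeasurableSet.univ, Set.univ_inter,
    smul_eq_mul, ENNReal.inv_mul_cancel hpA (measure_ne_top P A)]⟩

/-- **The energy floor on an almost-invariant face.** Given the floor `e* ≤ E_Q[rootEnergy]` for
every point-stationary a.s.-`δ`-hard-core probability law `Q`: for a point-stationary
a.s.-`δ`-hard-core probability law `P` and a measurable almost re-rooting-invariant event `B` with
`P(B) > 0`, `P(B)·e* ≤ ∫_B rootEnergy dP`, and the conditioned law has mean root energy
`P(B)⁻¹ ∫_B rootEnergy dP`. [folklore] -/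
theorem measure_mul_eStar_le_setIntegral
    (hU : ∀ δ : ℝ, 0 < δ → ∀ P : Measure (Measure (EuclideanSpace ℝ (Fin 3))),
      IsProbabilityMeasure P → (∀ᵐ μ ∂P, IsRootedHardCore δ μ) → IsPointStationaryLaw P →
      eStar ≤ ∫ μ, rootEnergy lennardJones μ ∂P)
    {δ : ℝ} (hδ : 0 < δ) (P : Measure (Measure (EuclideanSpace ℝ (Fin 3))))
    [IsProbabilityMeasure P] (hcore : ∀ᵐ μ ∂P, IsRootedHardCore δ μ)
    (hstat : IsPointStationaryLaw P) {B : Set (Measure (EuclideanSpace ℝ (Fin 3)))}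
    (hB : MeasurableSet B)
    (hinv : ∀ᵐ μ ∂P, ∀ᵐ y ∂μ, (Measure.map (fun z => z - y) μ ∈ B ↔ μ ∈ B)) (hpB : P B ≠ 0) :
    (P B).toReal * eStar ≤ ∫ μ in B, rootEnergy lennardJones μ ∂P ∧
      ∫ μ, rootEnergy lennardJones μ ∂((P B)⁻¹ • P.restrict B) =
        (P B).toReal⁻¹ * ∫ μ in B, rootEnergy lennardJones μ ∂P := by
  have hp_top : P B ≠ ⊤ := measure_ne_top P B
  haveI : IsProbabilityMeasure ((P B)⁻¹ • P.restrict B) := isProbabilityMeasure_cond hpB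
  have hstatB : IsPointStationaryLaw ((P B)⁻¹ • P.restrict B) :=
    (pureExhaustion_isPointStationaryLaw_restrict_of_ae P hstat B hB hinv).smul _
  have hcoreB : ∀ᵐ μ ∂((P B)⁻¹ • P.restrict B), IsRootedHardCore δ μ :=
    Measure.ae_smul_measure (ae_restrict_of_ae hcore) _
  have hEB : ∫ μ, rootEnergy lennardJones μ ∂((P B)⁻¹ • P.restrict B) =
      (P B).toReal⁻¹ * ∫ μ in B, rootEnergy lennardJones μ ∂P := by
    rw [integral_smul_measure, smul_eq_mul, ENNReal.toReal_inv]
  have hlow : eStar ≤ ∫ μ, rootEnergy lennardJones μ ∂((P B)⁻¹ • P.restrict B) :=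
    hU δ hδ _ inferInstance hcoreB hstatB
  refine ⟨?_, hEB⟩
  rw [hEB] at hlow
  have hpos : 0 < (P B).toReal := ENNReal.toReal_pos hpB hp_top
  calc (P B).toReal * eStar
      ≤ (P B).toReal * ((P B).toReal⁻¹ * ∫ μ in B, rootEnergy lennardJones μ ∂P) :=
        mul_le_mul_of_nonneg_left hlow hpos.le
    _ = ∫ μ in B, rootEnergy lennardJones μ ∂P := by
        rw [← mul_assoc, mul_inv_cancel₀ hpos.ne', one_mul]

/-- **The minimising face is closed under almost-invariant conditioning** (a.e. version of
`Rootedness.meanRootEnergy_cond_le_of_minimising`).  Given the energy floor `e* ≤ E_Q[rootEnergy]`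
for every point-stationary a.s.-`δ`-hard-core probability law `Q`: if `P` is such a law and
MINIMISING (`E_P[rootEnergy] ≤ e*`) and `A` is a measurable event, re-rooting-invariant for
`P`-a.e. configuration and a.e. point, with `P(A) > 0`, then the conditioned law `P(A)⁻¹ • P|A` is
minimising too (`E_P = P(A) E_A + P(Aᶜ) E_{Aᶜ}`, both conditional energies `≥ e*`, and `e* < 0`
by `eStar_le_neg`). [folklore] -/
theorem integral_rootEnergy_cond_le_of_ae
    (hU : ∀ δ : ℝ, 0 < δ → ∀ P : Measure (Measure (EuclideanSpace ℝ (Fin 3))),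
      IsProbabilityMeasure P → (∀ᵐ μ ∂P, IsRootedHardCore δ μ) → IsPointStationaryLaw P →
      eStar ≤ ∫ μ, rootEnergy lennardJones μ ∂P)
    {δ : ℝ} (hδ : 0 < δ) (P : Measure (Measure (EuclideanSpace ℝ (Fin 3))))
    [IsProbabilityMeasure P] (hcore : ∀ᵐ μ ∂P, IsRootedHardCore δ μ)
    (hstat : IsPointStationaryLaw P) (hE : ∫ μ, rootEnergy lennardJones μ ∂P ≤ eStar)
    {A : Set (Measure (EuclideanSpace ℝ (Fin 3)))} (hA : MeasurableSet A)
    (hinv : ∀ᵐ μ ∂P, ∀ᵐ y ∂μ, (Measure.map (fun z => z - y) μ ∈ A ↔ μ ∈ A)) (hpA : P A ≠ 0) :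
    ∫ μ, rootEnergy lennardJones μ ∂((P A)⁻¹ • P.restrict A) ≤ eStar := by
  have heneg : eStar < 0 := by linarith [eStar_le_neg]
  have hint : Integrable (fun μ : Measure (EuclideanSpace ℝ (Fin 3)) => rootEnergy lennardJones μ)
      P := by
    by_contra hni
    rw [integral_undef hni] at hE
    linarith
  have hsplit : ∫ μ, rootEnergy lennardJones μ ∂P =
      (∫ μ in A, rootEnergy lennardJones μ ∂P) + ∫ μ in Aᶜ, rootEnergy lennardJones μ ∂P :=
    (integral_add_compl hA hint).symm
  obtain ⟨-, hEA⟩ := measure_mul_eStar_le_setIntegral hU hδ P hcore hstat hA hinv hpA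
  have hposA : 0 < (P A).toReal := ENNReal.toReal_pos hpA (measure_ne_top P A)
  rw [hEA]
  -- it remains to see `∫_A rootEnergy ≤ P(A)·e*`
  suffices hmain : ∫ μ in A, rootEnergy lennardJones μ ∂P ≤ (P A).toReal * eStar by
    calc (P A).toReal⁻¹ * ∫ μ in A, rootEnergy lennardJones μ ∂P
        ≤ (P A).toReal⁻¹ * ((P A).toReal * eStar) :=
          mul_le_mul_of_nonneg_left hmain (inv_pos.2 hposA).le
      _ = eStar := by rw [← mul_assoc, inv_mul_cancel₀ hposA.ne', one_mul]
  have hsum : (P A).toReal + (P Aᶜ).toReal = 1 := by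
    rw [← ENNReal.toReal_add (measure_ne_top P A) (measure_ne_top P Aᶜ),
      measure_add_measure_compl hA, measure_univ, ENNReal.toReal_one]
  by_cases hqA : P Aᶜ = 0
  · have h0 : ∫ μ in Aᶜ, rootEnergy lennardJones μ ∂P = 0 := by
      rw [Measure.restrict_eq_zero.2 hqA, integral_zero_measure]
    have h1 : (P A).toReal = 1 := by
      rw [hqA, ENNReal.toReal_zero, add_zero] at hsum
      exact hsum
    have h2 : ∫ μ in A, rootEnergy lennardJones μ ∂P = ∫ μ, rootEnergy lennardJones μ ∂P := by
      rw [hsplit, h0, add_zero]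
    rw [h1, one_mul, h2]
    exact hE
  · obtain ⟨hAclow, -⟩ :=
      measure_mul_eStar_le_setIntegral hU hδ P hcore hstat hA.compl (ae_invariant_compl hinv) hqA
    rw [hsplit] at hE
    nlinarith

end PureExhaustion

end Summit.AtomisticToContinuum.Crystallization.Theorems.IsometryAtomsMinimisingLawsCohesive

end
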